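import Literature.NumberTheory.GaloisRepresentations.ShapiroInjective
import Literature.NumberTheory.GaloisRepresentations.CohomologicalDimensionProofs
import Literature.NumberTheory.GaloisRepresentations.ContinuousCupProductCompat
import Literature.NumberTheory.GaloisRepresentations.BrauerTowerBound
import HarnessLib

/-!
# Corestriction on continuous cohomology of profinite groups (Serre I §2.4–2.5), all degrees

For a profinite group `G`, a closed subgroup `S` and a discrete `G`-module `M` (`ρ`), the
**corestriction** `cor : H^q(S, M) → H^q(G, M)` is constructed at COCHAIN level as the composite of
the tree's Shapiro extension map `ext : C•(S, M) → C•(G, M_G^S(M))` (`extCochainsMap`, a section of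
the Shapiro map `sh`, `CohomologicalDimensionProofs.lean`) with the map induced by the norm
`M_G^S(M) → M` (`normCoind`, `IndexCoprimeTransfer.lean`):

* `cor ρ q := H^q(ext ≫ C•(norm))` (`corCochains`, `cor`);
* `sh_extMap` / `extMap_sh` — `sh ∘ H(ext) = id` and, in positive degrees, `H(ext) ∘ sh = id`
  (Shapiro injectivity on classes, `map_shapiro_eq_zero_imp`);
* `cor_resSub` — **`cor ∘ res = (G : S)`** for `S` open (`sh ∘ H(unit) = res`, `norm ∘ unit = (G:S)`);
* `cor_cupProduct_resSub` — **the projection formula `cor(res a ∪ b) = a ∪ cor b`** for a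
  continuous pairing `X × Y → Z` of discrete `G`-modules, `a ∈ H¹(G, X)`, `b ∈ H¹(S, Y)`, via the
  pairing `X × M_G^S(Y) → M_G^S(Z)`, `(x, F) ↦ (g ↦ ⟨g x, F g⟩)` (`coindPairing`), compatible with
  evaluation at `1` and with the norms.

## References
* J.-P. Serre, *Galois Cohomology*, Springer, 1997, I §2.4 (Prop. 9) and I §2.5 (Prop. 10). [SerreGaloisCohomology1997]
* J. Neukirch, A. Schmidt, K. Wingberg, *Cohomology of Number Fields*, 2008, I §5 (1.5.3 (iv), cor and cup). [NeukirchSchmidtWingberg2008]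
-/

noncomputable section

open CategoryTheory Function

universe u

namespace Literature.NumberTheory.GaloisRepresentations

open _root_.TopRep _root_.ContRepresentation _root_.ContinuousCohomology

set_option allowUnsafeReducibility true in
attribute [local reducible] CategoryTheory.Functor.mapHomologicalComplex

section Cor

variable {G : Type u} [Group G] [TopologicalSpace G] [IsTopologicalGroup G] [CompactSpace G]
  [T2Space G] [TotallyDisconnectedSpace G]
variable (S : Subgroup G) [hS : IsClosed (S : Set G)]
variable {M : Type u} [AddCommGroup M] [TopologicalSpace M] [DiscreteTopology M]

attribute [local instance] compactSpace_of_isClosed_subgroup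

/-- A continuous `S`-equivariant retraction `r : G → S` (`r(s x) = s r(x)`, `r|_S = id`), chosen
once (`exists_continuousMap_mul_eq`, Serre I §1.2 Prop. 1). [cite: SerreGaloisCohomology1997, I §1.2 Prop. 1] -/
def corRetraction : C(G, S) := (exists_continuousMap_mul_eq S hS).choose

/-- `r(s x) = s r(x)`. [folklore] -/
theorem corRetraction_mul : ∀ s ∈ S, ∀ x : G, (corRetraction S (s * x) : G) = s * corRetraction S x :=
  (exists_continuousMap_mul_eq S hS).choose_spec.1

/-- `r|_S = id`. [folklore] -/
theorem corRetraction_of_mem : ∀ s ∈ S, (corRetraction S s : G) = s :=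
  (exists_continuousMap_mul_eq S hS).choose_spec.2

variable (ρ : ContinuousRep G ℤ M)

/-- The identity `M_G^S(M|_S) → M_G^S(M|_S)` as the map `Λ₀` of the extension construction. [folklore] -/
def corLam : (ρ.restrict (subgroupIncl S)).toTopRep.ρ.coindV (subgroupIncl S) →L[ℤ]
    ((coindRep (ρ.restrict (subgroupIncl S))).toTopRep : Type u) where
  toFun φ := φ
  map_add' _ _ := rfl
  map_smul' _ _ := rfl
  cont := continuous_id

/-- **The extension cochain map `C•(S, M) → C•(G, M_G^S(M))`** (a section of the Shapiro map).
[cite: SerreGaloisCohomology1997, I §2.5 Prop. 10] -/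
abbrev extMapCochains : homogeneousCochains (ρ.restrict (subgroupIncl S)).toTopRep ⟶
    homogeneousCochains (coindRep (ρ.restrict (subgroupIncl S))).toTopRep :=
  extCochainsMap (coindRep (ρ.restrict (subgroupIncl S))).toTopRep (corRetraction_mul S) (corLam S ρ)
    (fun _ _ => rfl)

/-- The Shapiro map on `H^q`. [folklore] -/
abbrev shMap (q : ℕ) : continuousCohomology q (coindRep (ρ.restrict (subgroupIncl S))).toTopRep ⟶
    continuousCohomology q (ρ.restrict (subgroupIncl S)).toTopRep :=
  ContinuousCohomology.map (subgroupIncl S) (coindEvalOne (ρ.restrict (subgroupIncl S))) q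

/-- The extension map on `H^q`. [folklore] -/
abbrev extMap (q : ℕ) : continuousCohomology q (ρ.restrict (subgroupIncl S)).toTopRep ⟶
    continuousCohomology q (coindRep (ρ.restrict (subgroupIncl S))).toTopRep :=
  HomologicalComplex.homologyMap (extMapCochains S ρ) q

/-- **`sh ∘ ext = id` on `H^q`.** [cite: SerreGaloisCohomology1997, I §2.5 Prop. 10] -/
theorem sh_extMap (q : ℕ) (z : continuousCohomology q (ρ.restrict (subgroupIncl S)).toTopRep) :
    shMap S ρ q (extMap S ρ q z) = z := by
  have hcomp : extMap S ρ q ≫ shMap S ρ q = 𝟙 _ := by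
    rw [extMap, shMap, ContinuousCohomology.map, ← HomologicalComplex.homologyMap_comp,
      extCochainsMap_comp_cochainsMap _ (corRetraction_mul S) (corLam S ρ) (fun _ _ => rfl)
        (coindEvalOne (ρ.restrict (subgroupIncl S))) (fun _ => rfl) (corRetraction_of_mem S),
      HomologicalComplex.homologyMap_id]
  simpa using congr_arg (fun φ => φ.hom z) hcomp

/-- **`ext ∘ sh = id` on `H^{q+1}`** (Shapiro injectivity). [cite: SerreGaloisCohomology1997, I §2.5 Prop. 10] -/
theorem extMap_sh (q : ℕ) (y : continuousCohomology (q + 1) (coindRep (ρ.restrict (subgroupIncl S))).toTopRep) :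
    extMap S ρ (q + 1) (shMap S ρ (q + 1) y) = y := by
  have h : shMap S ρ (q + 1) (extMap S ρ (q + 1) (shMap S ρ (q + 1) y) - y) = 0 := by
    rw [map_sub, sh_extMap, sub_self]
  have h2 := map_shapiro_eq_zero_imp (ρ.restrict (subgroupIncl S)) q _ h
  rwa [sub_eq_zero] at h2

variable [Fintype (G ⧸ S)]

/-- **The corestriction cochain map `C•(S, M) → C•(G, M)`**: extension followed by the norm
`M_G^S(M) → M`. [cite: SerreGaloisCohomology1997, I §2.5] -/
abbrev corCochains : homogeneousCochains (ρ.restrict (subgroupIncl S)).toTopRep ⟶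
    homogeneousCochains ρ.toTopRep :=
  extMapCochains S ρ ≫ cochainsHom (normCoind ρ)

/-- **The corestriction `cor : H^q(S, M) → H^q(G, M)`.** [cite: SerreGaloisCohomology1997, I §2.5] -/
abbrev cor (q : ℕ) : continuousCohomology q (ρ.restrict (subgroupIncl S)).toTopRep ⟶
    continuousCohomology q ρ.toTopRep :=
  HomologicalComplex.homologyMap (corCochains S ρ) q

/-- `cor = H(norm) ∘ H(ext)`. [folklore] -/
theorem cor_apply (q : ℕ) (z : continuousCohomology q (ρ.restrict (subgroupIncl S)).toTopRep) :
    cor S ρ q z = cohomologyMap (normCoind ρ) q (extMap S ρ q z) := by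
  rw [cor, corCochains, HomologicalComplex.homologyMap_comp]
  rfl

/-- **`cor ∘ res = (G : S)`** on `H^{q+1}(G, M)` for `S` of finite index: `res = sh ∘ H(unit)`
(`resolutionMap_unitCoind`), `H(ext) ∘ sh = id` (`extMap_sh`), `norm ∘ unit = (G : S)`
(`normCoind_unitCoind`). [cite: SerreGaloisCohomology1997, I §2.4 Prop. 9] -/
theorem cor_resH (q : ℕ) (a : continuousCohomology (q + 1) ρ.toTopRep) :
    cor S ρ (q + 1) (resH S ρ (q + 1) a) = S.index • a := by
  classical
  obtain ⟨c, hc, rfl⟩ := cxClass_surjective (homogeneousCochains ρ.toTopRep) (q + 1) (q + 2) (up_nat_next (q + 1)) a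
  -- `res a = sh (H(unit) a)` on classes
  have hua : (homogeneousCochains (coindRep (ρ.restrict (subgroupIncl S))).toTopRep).d (q + 1) (q + 2)
      ((cochainsHom (unitCoind (S := S) ρ)).f (q + 1) c) = 0 := by
    rw [hom_f_d_apply (cochainsHom (unitCoind (S := S) ρ)) (q + 1) (q + 2) c, hc, hom_f_apply_zero]
  have hres : resH S ρ (q + 1) (cxClass _ (q + 1) (q + 2) (up_nat_next (q + 1)) c hc) =
      shMap S ρ (q + 1) (cxClass _ (q + 1) (q + 2) (up_nat_next (q + 1)) _ hua) := by
    unfold resH shMap ContinuousCohomology.map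
    rw [homologyMap_cxClass _ (q + 1) (q + 2) (up_nat_next (q + 1)) c hc _
        (by rw [hom_f_d_apply, hc, map_zero]) rfl,
      homologyMap_cxClass _ (q + 1) (q + 2) (up_nat_next (q + 1)) _ hua _
        (by rw [hom_f_d_apply, hua, map_zero]) rfl]
    refine cxClass_congr (Subtype.ext ?_)
    exact (resolutionMap_unitCoind ρ (q + 2) c.1).symm
  rw [hres, cor_apply, extMap_sh]
  -- `H(norm) (H(unit) a) = (G : S) • a`
  change HomologicalComplex.homologyMap (cochainsHom (normCoind ρ)) (q + 1) _ = _
  -- `[m • c] = m • [c]` (by additivity, in this specific context to keep the scalar actions syntactically equal)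
  have key : ∀ (m : ℕ) (hm : (homogeneousCochains ρ.toTopRep).d (q + 1) (q + 2) (m • c) = 0),
      cxClass (homogeneousCochains ρ.toTopRep) (q + 1) (q + 2) (up_nat_next (q + 1)) (m • c) hm =
        m • cxClass (homogeneousCochains ρ.toTopRep) (q + 1) (q + 2) (up_nat_next (q + 1)) c hc := by
    intro m
    induction m with
    | zero =>
      intro hm
      rw [(zero_nsmul _ : 0 • cxClass (homogeneousCochains ρ.toTopRep) (q + 1) (q + 2) (up_nat_next (q + 1)) c hc = 0)]
      have h0 : (homogeneousCochains ρ.toTopRep).d (q + 1) (q + 2) 0 = 0 := map_zero _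
      exact (cxClass_congr (hx' := h0) (zero_nsmul c)).trans
        ((cxClass_eq_zero_iff _ (q + 1) (q + 2) (up_nat_next (q + 1)) q (up_nat_prev_succ q) 0 h0).2
          ⟨0, map_zero _⟩)
    | succ m ih =>
      intro hm
      have hm' : (homogeneousCochains ρ.toTopRep).d (q + 1) (q + 2) (m • c) = 0 := by
        rw [map_nsmul, hc, nsmul_zero]
      rw [(succ_nsmul _ m : (m + 1) • cxClass (homogeneousCochains ρ.toTopRep) (q + 1) (q + 2)
        (up_nat_next (q + 1)) c hc = _), ← ih hm', ← cxClass_add]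
      exact cxClass_congr (succ_nsmul c m)
  refine Eq.trans (homologyMap_cxClass _ (q + 1) (q + 2) (up_nat_next (q + 1)) _ hua _ _ ?_)
    (key S.index (by rw [map_nsmul, hc, nsmul_zero]))
  -- `(G : S) • c = norm (unit c)` on cochains
  rw [← cochainsHom_comp_apply']
  apply Subtype.ext
  rw [cochainsHom_f_coe, resolutionHom_eq_nsmul (unitCoind (S := S) ρ ≫ normCoind ρ) S.index
    (fun v => by
      change (normCoind ρ).hom ((unitCoind (S := S) ρ).hom v) = S.index • v
      rw [normCoind_unitCoind, Subgroup.index_eq_card, Nat.card_eq_fintype_card]) (q + 2) c.1]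
  rfl

end Cor

/-! ### The projection formula `cor(res a ∪ b) = a ∪ cor b` -/

section Projection

variable {G : Type u} [Group G] [TopologicalSpace G] [IsTopologicalGroup G] [CompactSpace G]
variable (S : Subgroup G)
variable {MX MY MZ : Type u} [AddCommGroup MX] [TopologicalSpace MX] [DiscreteTopology MX]
  [AddCommGroup MY] [TopologicalSpace MY] [DiscreteTopology MY]
  [AddCommGroup MZ] [TopologicalSpace MZ] [DiscreteTopology MZ]
variable (ρX : ContinuousRep G ℤ MX) (ρY : ContinuousRep G ℤ MY) (ρZ : ContinuousRep G ℤ MZ)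
variable (P : ContPairing ρX.toTopRep ρY.toTopRep ρZ.toTopRep)

attribute [local instance] discreteTopology_coind

/-- `P̃(x, F) = (g ↦ ⟨g x, F g⟩) ∈ M_G^S(Z)` for `x ∈ X`, `F ∈ M_G^S(Y)`. [folklore] -/
def coindPairFun (x : MX) (F : coindModule (ρY.restrict (subgroupIncl S))) :
    coindModule (ρZ.restrict (subgroupIncl S)) :=
  ⟨⟨fun g => P.toLin (ρX g x) ((F : C(G, MY)) g),
    (continuous_of_discreteTopology (f := fun q : MX × MY => P.toLin q.1 q.2)).comp
      ((ρX.continuous_apply_left x).prodMk (F : C(G, MY)).continuous)⟩, fun s g => by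
    change P.toLin (ρX ((s : G) * g) x) ((F : C(G, MY)) ((s : G) * g)) =
      (ρZ.restrict (subgroupIncl S)) s (P.toLin (ρX g x) ((F : C(G, MY)) g))
    rw [(mem_coind_iff (ρY.restrict (subgroupIncl S)) _).1 F.2 s g, ContinuousRep.restrict_apply,
      ContinuousRep.restrict_apply, subgroupIncl_apply, map_mul, Module.End.mul_apply]
    exact P.toLin_smul (s : G) (ρX g x) ((F : C(G, MY)) g)⟩

omit [IsTopologicalGroup G] [CompactSpace G] in
/-- Unfolding `coindPairFun`. [folklore] -/
@[simp] theorem coindPairFun_coe_apply (x : MX) (F : coindModule (ρY.restrict (subgroupIncl S))) (g : G) :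
    ((coindPairFun S ρX ρY ρZ P x F : coindModule (ρZ.restrict (subgroupIncl S))) : C(G, MZ)) g =
      P.toLin (ρX g x) ((F : C(G, MY)) g) := rfl

/-- **The pairing `X × M_G^S(Y) → M_G^S(Z)`, `(x, F) ↦ (g ↦ ⟨g x, F g⟩)`**, `G`-equivariant.
[cite: NeukirchSchmidtWingberg2008, I §5 (1.5.3)] -/
def coindPairing : ContPairing ρX.toTopRep (coindRep (ρY.restrict (subgroupIncl S))).toTopRep
    (coindRep (ρZ.restrict (subgroupIncl S))).toTopRep :=
  ContPairing.ofDiscrete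
    (LinearMap.mk₂ ℤ (coindPairFun S ρX ρY ρZ P)
      (fun x x' F => Subtype.ext (ContinuousMap.ext fun g => by
        change P.toLin (ρX g (x + x')) _ = P.toLin (ρX g x) _ + P.toLin (ρX g x') _
        rw [map_add, map_add, LinearMap.add_apply]))
      (fun c x F => Subtype.ext (ContinuousMap.ext fun g => by
        change P.toLin (ρX g (c • x)) _ = c • P.toLin (ρX g x) _
        rw [map_zsmul, map_zsmul, LinearMap.smul_apply]))
      (fun x F F' => Subtype.ext (ContinuousMap.ext fun g => by
        change P.toLin (ρX g x) ((F : C(G, MY)) g + (F' : C(G, MY)) g) = P.toLin (ρX g x) _ + P.toLin (ρX g x) _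
        rw [map_add]))
      (fun c x F => Subtype.ext (ContinuousMap.ext fun g => by
        change P.toLin (ρX g x) (c • (F : C(G, MY)) g) = c • P.toLin (ρX g x) _
        rw [map_zsmul])))
    (fun h x F => Subtype.ext (ContinuousMap.ext fun g => by
      change P.toLin (ρX g (ρX.toTopRep.ρ h x)) ((((coindRep (ρY.restrict (subgroupIncl S))).toTopRep.ρ h F :
          coindModule (ρY.restrict (subgroupIncl S))) : C(G, MY)) g) =
        ((((coindRep (ρZ.restrict (subgroupIncl S))).toTopRep.ρ h (coindPairFun S ρX ρY ρZ P x F) :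
          coindModule (ρZ.restrict (subgroupIncl S))) : C(G, MZ)) g)
      rw [ContinuousRep.toTopRep_ρ_apply, ContinuousRep.toTopRep_ρ_apply, ContinuousRep.toTopRep_ρ_apply,
        coindRep_apply_apply, coindRep_apply_apply, coindPairFun_coe_apply, _root_.map_mul ρX, Module.End.mul_apply]))

/-- Unfolding `coindPairing`. [folklore] -/
@[simp] theorem coindPairing_toLin_apply (x : MX) (F : coindModule (ρY.restrict (subgroupIncl S))) :
    (coindPairing S ρX ρY ρZ P).toLin x F = coindPairFun S ρX ρY ρZ P x F := rfl

/-- The pairing `P` on the restrictions to `S`. [folklore] -/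
def resPairing : ContPairing (ρX.restrict (subgroupIncl S)).toTopRep (ρY.restrict (subgroupIncl S)).toTopRep
    (ρZ.restrict (subgroupIncl S)).toTopRep where
  toLin := P.toLin
  continuous_toLin := P.continuous_toLin
  toLin_smul s x y := P.toLin_smul (s : G) x y

/-- `ev₁(P̃(x, F)) = ⟨x, ev₁ F⟩`. [folklore] -/
theorem coindEvalOne_coindPairing (x : MX) (F : coindModule (ρY.restrict (subgroupIncl S))) :
    (coindEvalOne (ρZ.restrict (subgroupIncl S))).hom ((coindPairing S ρX ρY ρZ P).toLin x F) =
      P.toLin x ((coindEvalOne (ρY.restrict (subgroupIncl S))).hom F) := by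
  rw [coindEvalOne_apply, coindEvalOne_apply, coindPairing_toLin_apply, coindPairFun_coe_apply, map_one,
    Module.End.one_apply]

variable [T2Space G] [TotallyDisconnectedSpace G] [hS : IsClosed (S : Set G)]

attribute [local instance] compactSpace_of_isClosed_subgroup

omit [TotallyDisconnectedSpace G] in
/-- **Shapiro compatibility of the cup product**: `sh_Z(a ∪_{P̃} b̃) = res a ∪_P sh_Y(b̃)`.
[cite: NeukirchSchmidtWingberg2008, I §5 (1.5.3)] -/
theorem shMap_cupProduct_coindPairing (a : continuousCohomology 1 ρX.toTopRep)
    (bt : continuousCohomology 1 (coindRep (ρY.restrict (subgroupIncl S))).toTopRep) :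
    shMap S ρZ 2 ((coindPairing S ρX ρY ρZ P).cupProduct a bt) =
      (resPairing S ρX ρY ρZ P).cupProduct (resH S ρX 1 a) (shMap S ρY 1 bt) := by
  -- `sh = H(ev₁) ∘ res`
  have hshZ : shMap S ρZ 2 ((coindPairing S ρX ρY ρZ P).cupProduct a bt) =
      cohomologyMap (coindEvalOne (ρZ.restrict (subgroupIncl S))) 2
        (ContinuousCohomology.map (subgroupIncl S)
          (𝟙 (TopRep.res (subgroupIncl S : S →* G) (coindRep (ρZ.restrict (subgroupIncl S))).toTopRep)) 2
          ((coindPairing S ρX ρY ρZ P).cupProduct a bt)) :=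
    map_comp_apply_of (subgroupIncl S) (ContinuousMonoidHom.id S) (subgroupIncl S) (fun _ => rfl)
      (𝟙 _) (resIdHom (coindEvalOne (ρZ.restrict (subgroupIncl S)))) (coindEvalOne (ρZ.restrict (subgroupIncl S)))
      (fun _ => rfl) 2 _
  have hshY : shMap S ρY 1 bt =
      cohomologyMap (coindEvalOne (ρY.restrict (subgroupIncl S))) 1
        (ContinuousCohomology.map (subgroupIncl S)
          (𝟙 (TopRep.res (subgroupIncl S : S →* G) (coindRep (ρY.restrict (subgroupIncl S))).toTopRep)) 1 bt) :=
    map_comp_apply_of (subgroupIncl S) (ContinuousMonoidHom.id S) (subgroupIncl S) (fun _ => rfl)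
      (𝟙 _) (resIdHom (coindEvalOne (ρY.restrict (subgroupIncl S)))) (coindEvalOne (ρY.restrict (subgroupIncl S)))
      (fun _ => rfl) 1 _
  have hX : resH S ρX 1 a =
      cohomologyMap (𝟙 ((ρX.restrict (subgroupIncl S)).toTopRep)) 1
        (ContinuousCohomology.map (subgroupIncl S)
          (𝟙 (TopRep.res (subgroupIncl S : S →* G) ρX.toTopRep)) 1 a) :=
    map_comp_apply_of (subgroupIncl S) (ContinuousMonoidHom.id S) (subgroupIncl S) (fun _ => rfl)
      (𝟙 _) (resIdHom (𝟙 _)) (𝟙 _) (fun _ => rfl) 1 _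
  rw [hshZ, ContPairing.cupProduct_res, hshY, hX]
  exact ContPairing.cupProduct_map ((coindPairing S ρX ρY ρZ P).restrict (subgroupIncl S))
    (resPairing S ρX ρY ρZ P) (𝟙 _) (coindEvalOne (ρY.restrict (subgroupIncl S)))
    (coindEvalOne (ρZ.restrict (subgroupIncl S))) (fun x F => coindEvalOne_coindPairing S ρX ρY ρZ P x F) _ _

variable [Fintype (G ⧸ S)]

omit [T2Space G] [TotallyDisconnectedSpace G] hS in
/-- **`norm(P̃(x, F)) = ⟨x, norm F⟩`.** [folklore] -/
theorem normCoind_coindPairing (x : MX) (F : coindModule (ρY.restrict (subgroupIncl S))) :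
    (normCoind ρZ).hom ((coindPairing S ρX ρY ρZ P).toLin x F) = P.toLin x ((normCoind ρY).hom F) := by
  rw [normCoind_hom_apply, normCoind_hom_apply, map_sum]
  refine Finset.sum_congr rfl fun c _ => ?_
  rw [coindPairing_toLin_apply, coindPairFun_coe_apply]
  have h := P.toLin_smul c.out (ρX c.out⁻¹ x) ((F : C(G, MY)) c.out⁻¹)
  rw [ContinuousRep.toTopRep_ρ_apply, ContinuousRep.toTopRep_ρ_apply, ContinuousRep.toTopRep_ρ_apply,
    ← Module.End.mul_apply, ← map_mul, mul_inv_cancel, map_one, Module.End.one_apply] at h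
  exact h.symm

/-- **The projection formula `cor(res a ∪ b) = a ∪ cor b`** (`a ∈ H¹(G, X)`, `b ∈ H¹(S, Y)`).
[cite: NeukirchSchmidtWingberg2008, I §5 Prop. 1.5.3 (iv)] -/
theorem cor_cupProduct_resH (a : continuousCohomology 1 ρX.toTopRep)
    (b : continuousCohomology 1 (ρY.restrict (subgroupIncl S)).toTopRep) :
    cor S ρZ 2 ((resPairing S ρX ρY ρZ P).cupProduct (resH S ρX 1 a) b) = P.cupProduct a (cor S ρY 1 b) := by
  have hb : shMap S ρY 1 (extMap S ρY 1 b) = b := sh_extMap S ρY 1 b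
  conv_lhs => rw [← hb]
  rw [← shMap_cupProduct_coindPairing, cor_apply, extMap_sh, cor_apply,
    ContPairing.cupProduct_map (coindPairing S ρX ρY ρZ P) P (𝟙 _) (normCoind ρY) (normCoind ρZ)
      (fun x F => normCoind_coindPairing S ρX ρY ρZ P x F),
    show cohomologyMap (𝟙 ρX.toTopRep) 1 a = a from
      map_apply_of_id (ContinuousMonoidHom.id G) (fun _ => rfl) (resIdHom (𝟙 ρX.toTopRep)) (fun _ => rfl) 1 a]

end Projection

end Literature.NumberTheory.GaloisRepresentations

end
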